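import Mathlib
import Literature.MathematicalPhysics.QuantumFieldTheory.Balaban1983to89.B15LatticeCubeTorus

/-!
# `Balaban1983to89.B15TouchingCubeLowerBound` — the (2.61) row sum of [Balaban1984PropagatorsII] Lemma 2.1 under the
# TOUCHING-CUBE reading R2 of (2.46) has NO `L`-free constant: at a coarse cube next to a refined cell it is `≥ L^{d−1}e^{−σ}`
# (GAPS G-B6-22 item (iii), kernel-certified; contrast: print's literal reading R0 has the d-only constant c₁″)

statement-level skeleton of published theorems with citation tags; proofs where landed; nothing here is a claim about the Yang–Mills mass gap

CITATION HEADER (lean-in-tree rule 2026-08-18).  Sources: T. Bałaban, *Propagators and renormalization transformations for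
lattice gauge theories. II*, Commun. Math. Phys. **96** (1984) 223–250 [Balaban1984PropagatorsII] (Lemma 2.1 (2.61) p. 234,
(2.45)–(2.46) p. 231); T. Bałaban, *Large field renormalization. I*, Commun. Math. Phys. **122** (1989) 175–202
[Balaban1989LargeFieldI] (p. 179 the nested `Z″_n`, p. 186 the cube model).  WHAT IS REPRODUCED: lit-balaban SKELETON rows
**B6.Eq2.45**/(2.46) and **B6.Lem2.1** (cells only; heads unchanged) — the located reading GAPS G-B6-22 (three readings R0 ⊂ R1,
R2 of the interface bonds of (2.46); item (iii) «no L-free (2.61) constant under R2», recorded by p29 g12 and accepted into the B6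
register by r03 g12) is made a THEOREM.  Mega-formalization `lit-balaban`, HOME `run/shared/lean/pub/lit-balaban/`; Phase-2 proof
seat p29 gen 13 (unit `lit-balaban-p29`), free-target protocol G.5-34(d).  KNITTING — used BY NAME: `B15LatticeCubeTorus.{twoScaleZ,
cellA, twoScaleZ_K, twoScaleZ_of_lt, twoScaleZ_of_gt}` (p321735: the two-scale nested cube family — nested, separating layer
void, tiling, periodic), `B15TouchingCubeContours.{touchC, touchC_adj, touchGeo, mem_cube_iff_cubeIdx}` (p314807),
`B15Ineq147Admissible.Touching` (p301778), `B15Ineq147LevelGap.{CubeSite, cube, toR}` (p299858), r11 `B14DomainGeom.cubeIdx`,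
`B11SectG.RowSum`.

THE PRINTED TEXT.  [B6] p. 231: *«a part of Γ contained in B^j(Λ_j) consists of bonds of the lattice Λ_j … d(y, y′) = inf_Γ …
(2.46)»*; p. 234 (2.61) *«sup_y Σ_{y′∈𝔅} e^{−αδ₀d(y,y′)} ≤ c₁(α)»* with *«c₁(α) = 12c₀(½α)^d»* — a constant depending on d and α
only.  The tree carries three typed readings of the admissible bonds ACROSS an interface (GAPS G-B6-22): R0 (print-literal: one
bond of the lattice of one of the two cubes; `B15LatticeCubeContours.latC`), R1 (`BondScale`), R2 (touching blocks, corner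
contacts included; `B15TouchingCubeContours.touchC`), with d_R2 ≤ d_R0 ≤ d_R1.

WHAT THIS FILE PROVES (kernel-checked, zero `sorry`; definitions with bodies `FaceIdx`, `faceVec`, `coarseSite`, `fineSite`,
`witnessF`; theorems otherwise; no named fact; axioms standard).  On the cover ℤᵈ of the two-scale family `twoScaleZ M₁ L K N`
(`M₁ ≥ 1`, `L ≥ 1`, `K ≥ 1`, `N ≥ 2`): §1 the `L^{d−1}` finer cubes (scale `K − 1`) of the refined cell `[0, M₁L^K)ᵈ` along its
face `x₀ = M₁L^K` (`card_faceIdx`); §2 the coarse cube (scale `K`, index `e₀`) next to the cell IS a cube-site (`coarseSite`),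
the finer cubes ARE cube-sites (`fineSite`), and **`touching_coarse_fine`** / `touchC_dist_coarse_fine`: the coarse cube touches
every one of them (R2 distance exactly `1`); §3 **`le_rowSum_touchGeo`** — for every finite `F` containing these cubes and every
rate `σ`, `L^{d−1}e^{−σ} ≤ Σ_{y′∈F} e^{−σ d_{R2}(y₀,y′)}` at the coarse cube; **`not_rowSum_touchGeo`** — `RowSum (touchGeo …) σ c`
FAILS for every `c < L^{d−1}e^{−σ}`; **`exists_rowSum_violation`** — for `d ≥ 2` and EVERY `c`, `σ` there is an `L` (namely
`⌈c e^{σ}⌉ + 2`) and a finite set of cube-sites of a legitimate nested cube family violating `RowSum σ c` under R2.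
CONSEQUENCE (recorded, not a head change): any (2.61) constant for reading R2 must grow at least like `L^{d−1}` — consistent with
the tree's `L`-dependent `K261` (`B15TouchingCubeContours.rowSum_touchGeo`) and in contrast with the d-only c₁″ PROVED for print's
literal reading R0 (`B15LatticeCubeContours.sum_exp_le_latC`, `B15LatticeCubeTorus.sum_exp_le_torC`): the printed «c₁(α) depends on
d, α only» is compatible with R0, not with R2.
HONEST SCOPE.  (i) A statement about the TREE's reading R2 (a model of p. 231's admissible bonds, declared in
`B15TouchingCubeContours`), not about print: print's bonds are lattice bonds (R0).  (ii) The witness family has two scales (the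
separating-layer hypothesis is void there); the phenomenon is the `L^{d−1}` finer cubes touching one coarse face, present in every
nested cube family with a refined region.  (iii) No head of any SKELETON row changes; bookkeeping of a located reading; NOT progress
on any Clay problem.
-/

namespace Literature.MathematicalPhysics.QuantumFieldTheory.Balaban1983to89.B15TouchingCubeLowerBound

open Literature.MathematicalPhysics.QuantumFieldTheory.Balaban1983to89
open B6Geometry B15Ineq147LevelGap B15Ineq147Admissible B14DomainGeom B15TouchingCubeContours B15LatticeCubeTorus
  B11SectG Finset

variable {d : ℕ} [NeZero d] {M₁ L K N : ℕ}

/-! ## §1 The `L^{d−1}` finer cubes of the refined cell along one face of the neighbouring coarse cube -/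

/-- Index set of the finer cubes of the cell `[0, M₁L^K)ᵈ` adjacent to its face `x₀ = M₁L^K`: one cube index `< L` in each of
the `d − 1` tangential directions. [cite: Balaban1989LargeFieldI, p.179; Balaban1984PropagatorsII, (2.46) p.231] -/
abbrev FaceIdx (d L : ℕ) [NeZero d] : Type := {μ : Fin d // ¬ μ = 0} → Fin L

/-- There are `L^{d−1}` of them. [cite: Balaban1989LargeFieldI, p.179] -/
theorem card_faceIdx : Fintype.card (FaceIdx d L) = L ^ (d - 1) := by
  rw [Fintype.card_fun, Fintype.card_fin]
  congr 1
  rw [Fintype.card_subtype_compl, Fintype.card_fin, Fintype.card_subtype_eq]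

/-- The scale-`(K−1)` cube index of the finer cube `b`: `L − 1` in the normal direction, `b_μ` tangentially.
[cite: Balaban1989LargeFieldI, p.179, p.186] -/
def faceVec (L : ℕ) (b : FaceIdx d L) : Fin d → ℤ :=
  fun μ => if h : μ = 0 then (L : ℤ) - 1 else ((b ⟨μ, h⟩ : ℕ) : ℤ)

/-- Distinct indices give distinct cubes. [folklore] -/
private theorem faceVec_injective : Function.Injective (faceVec (d := d) L) := by
  intro b c hbc
  funext x
  obtain ⟨μ, hμ⟩ := x
  have e := congrFun hbc μ
  simp only [faceVec, hμ, dite_false] at e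
  exact Fin.ext (by exact_mod_cast e)

/-- Bounds of the index vector: `0 ≤ (faceVec b)_μ ≤ L − 1` (`L ≥ 1`). [folklore] -/
private theorem faceVec_bounds (hL : 1 ≤ L) (b : FaceIdx d L) (μ : Fin d) :
    0 ≤ faceVec L b μ ∧ faceVec L b μ ≤ (L : ℤ) - 1 := by
  unfold faceVec
  split_ifs with h
  · constructor <;> omega
  · have := (b ⟨μ, h⟩).2
    constructor <;> omega

/-- At the normal direction the index is `L − 1`. [folklore] -/
private theorem faceVec_zero (b : FaceIdx d L) : faceVec L b 0 = (L : ℤ) - 1 := by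
  simp [faceVec]

/-! ## §2 The two cube-sites of the two-scale family `twoScaleZ` (the cover of the two-scale torus of `B15LatticeCubeTorus` §5) -/

/-- **The coarse cube next to the refined cell**: scale `K`, index `e₀ = (1, 0, …, 0)` — not a cell (its index is not divisible by
`N ≥ 2` in the normal direction), hence a cube-site of the layer `ℤᵈ∖cellA`. [cite: Balaban1989LargeFieldI, p.179, p.186; Balaban1984PropagatorsII, (2.45) p.231] -/
def coarseSite (M₁ L K N : ℕ) (hM₁ : 0 < M₁) (hL : 1 ≤ L) (hN : 2 ≤ N) :
    CubeSite M₁ L (twoScaleZ (d := d) M₁ L K N) :=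
  ⟨(K, Pi.single 0 1), fun x hx => by
    have hS : 0 < M₁ * L ^ K := Nat.mul_pos hM₁ (Nat.pow_pos (by omega))
    change x ∈ cube M₁ L K (Pi.single 0 1) at hx
    change x ∈ twoScaleZ M₁ L K N (K + 1) \ twoScaleZ M₁ L K N K
    rw [twoScaleZ_of_gt (Nat.lt_succ_self K), twoScaleZ_K]
    refine ⟨trivial, fun hA => ?_⟩
    have h0 := hA 0
    have hidx : cubeIdx (M₁ * L ^ K) x = Pi.single 0 1 := (mem_cube_iff_cubeIdx hS).mp hx
    rw [hidx, Pi.single_eq_same] at h0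
    have : N ∣ 1 := by exact_mod_cast h0
    have := Nat.eq_one_of_dvd_one this
    omega⟩

/-- **The finer cubes of the cell along that face**: scale `K − 1`, index `faceVec b` — their cubes lie in the cell `[0, M₁L^K)ᵈ`
(`K ≥ 1`, `L ≥ 1`, `M₁ ≥ 1`). [cite: Balaban1989LargeFieldI, p.179, p.186; Balaban1984PropagatorsII, (2.45) p.231] -/
def fineSite (M₁ L K N : ℕ) (hM₁ : 0 < M₁) (hL : 1 ≤ L) (hK : 1 ≤ K) (b : FaceIdx d L) :
    CubeSite M₁ L (twoScaleZ (d := d) M₁ L K N) :=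
  ⟨(K - 1, faceVec L b), fun x hx => by
    have hS' : 0 < M₁ * L ^ (K - 1) := Nat.mul_pos hM₁ (Nat.pow_pos (by omega))
    have hKK : K - 1 + 1 = K := by omega
    change x ∈ cube M₁ L (K - 1) (faceVec L b) at hx
    change x ∈ twoScaleZ M₁ L K N (K - 1 + 1) \ twoScaleZ M₁ L K N (K - 1)
    rw [hKK, twoScaleZ_K, twoScaleZ_of_lt (by omega)]
    refine ⟨fun μ => ?_, fun h => h⟩
    -- the scale-K cube index of `x` is 0: `0 ≤ x_μ < M₁L^{K−1}·L = M₁L^K`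
    have hb := faceVec_bounds hL b μ
    have h1 := (hx μ).1
    have h2 := (hx μ).2
    have hSS : ((M₁ * L ^ K : ℕ) : ℤ) = ((M₁ * L ^ (K - 1) : ℕ) : ℤ) * (L : ℤ) := by
      rw [← Nat.cast_mul, mul_assoc, ← pow_succ, hKK]
    have hS'pos : (0 : ℤ) < ((M₁ * L ^ (K - 1) : ℕ) : ℤ) := by exact_mod_cast hS'
    have hx0 : 0 ≤ x μ := le_trans (mul_nonneg hS'pos.le hb.1) h1
    have hxS : x μ < ((M₁ * L ^ K : ℕ) : ℤ) := by
      rw [hSS]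
      calc x μ < ((M₁ * L ^ (K - 1) : ℕ) : ℤ) * (faceVec L b μ + 1) := h2
        _ ≤ ((M₁ * L ^ (K - 1) : ℕ) : ℤ) * (L : ℤ) := mul_le_mul_of_nonneg_left (by linarith [hb.2]) hS'pos.le
    have : cubeIdx (M₁ * L ^ K) x μ = 0 := by
      unfold cubeIdx
      exact Int.ediv_eq_zero_of_lt hx0 hxS
    rw [this]
    exact dvd_zero _⟩

section Fixed

variable {hM₁ : 0 < M₁} {hL : 1 ≤ L} {hK : 1 ≤ K} {hN : 2 ≤ N}

/-- The finer cubes are pairwise distinct. [folklore] -/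
private theorem fineSite_injective : Function.Injective (fineSite (d := d) M₁ L K N hM₁ hL hK) := by
  intro b c hbc
  have := congrArg (fun s : CubeSite M₁ L (twoScaleZ (d := d) M₁ L K N) => s.1.2) hbc
  exact faceVec_injective this

/-- A coarse cube is not a finer cube (the scales differ, `K ≥ 1`). [folklore] -/
private theorem coarse_ne_fine (b : FaceIdx d L) :
    coarseSite (d := d) M₁ L K N hM₁ hL hN ≠ fineSite M₁ L K N hM₁ hL hK b := by
  intro h
  have := congrArg (fun s : CubeSite M₁ L (twoScaleZ (d := d) M₁ L K N) => s.1.1) h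
  simp only [coarseSite, fineSite] at this
  omega

omit [NeZero d] in
/-- Two lattice points differing by one unit in one coordinate are at sup-distance `≤ 1`. [folklore] -/
private theorem dist_update_le_one (x : Fin d → ℤ) (μ : Fin d) (v : ℤ) :
    dist (toR (Function.update x μ (v + 1))) (toR (Function.update x μ v)) ≤ 1 := by
  refine (dist_pi_le_iff zero_le_one).mpr fun ν => ?_
  rw [Real.dist_eq]
  unfold toR
  by_cases hν : ν = μ
  · subst hν
    simp
  · simp [Function.update_of_ne hν]

/-- **THE COARSE CUBE TOUCHES EVERY ONE OF THE `L^{d−1}` FINER CUBES** (the lattice points `(M₁L^K, M₁L^{K−1}b)` of the coarse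
cube and `(M₁L^K − 1, M₁L^{K−1}b)` of the finer cube `b` are at sup-distance `1`). [cite: Balaban1984PropagatorsII, (2.46) p.231; Balaban1989LargeFieldI, p.186] -/
theorem touching_coarse_fine (b : FaceIdx d L) :
    Touching (coarseSite (d := d) M₁ L K N hM₁ hL hN) (fineSite M₁ L K N hM₁ hL hK b) := by
  have hKK : K - 1 + 1 = K := by omega
  have hS' : 0 < M₁ * L ^ (K - 1) := Nat.mul_pos hM₁ (Nat.pow_pos (by omega))
  have hS'pos : (0 : ℤ) < ((M₁ * L ^ (K - 1) : ℕ) : ℤ) := by exact_mod_cast hS'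
  have hSS : ((M₁ * L ^ K : ℕ) : ℤ) = ((M₁ * L ^ (K - 1) : ℕ) : ℤ) * (L : ℤ) := by
    rw [← Nat.cast_mul, mul_assoc, ← pow_succ, hKK]
  set S : ℤ := ((M₁ * L ^ K : ℕ) : ℤ) with hSdef
  set S' : ℤ := ((M₁ * L ^ (K - 1) : ℕ) : ℤ) with hS'def
  set base : Fin d → ℤ := fun μ => S' * faceVec L b μ with hbase
  refine ⟨Function.update base 0 (S - 1 + 1), ?_, Function.update base 0 (S - 1), ?_, dist_update_le_one base 0 (S - 1)⟩
  · -- the point `(S, S'b)` of the coarse cube (index `e₀`)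
    intro μ
    change S * (Pi.single (0 : Fin d) (1 : ℤ) : Fin d → ℤ) μ ≤ _ ∧ _ < S * ((Pi.single (0 : Fin d) (1 : ℤ) : Fin d → ℤ) μ + 1)
    by_cases hμ : μ = 0
    · subst hμ
      rw [Function.update_self, Pi.single_eq_same]
      have : (0 : ℤ) < S := by rw [hSdef]; exact_mod_cast Nat.mul_pos hM₁ (Nat.pow_pos (by omega))
      constructor <;> linarith
    · rw [Function.update_of_ne hμ, Pi.single_eq_of_ne hμ, hbase]
      simp only [mul_zero, zero_add, mul_one]
      have hb := faceVec_bounds hL b μ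
      refine ⟨mul_nonneg hS'pos.le hb.1, ?_⟩
      have e1 : S = S' * ((L : ℤ) - 1) + S' := by rw [hSS]; ring
      rw [e1]
      have := mul_le_mul_of_nonneg_left hb.2 hS'pos.le
      linarith
  · -- the point `(S − 1, S'b)` of the finer cube `b`
    intro μ
    change S' * faceVec L b μ ≤ _ ∧ _ < S' * (faceVec L b μ + 1)
    by_cases hμ : μ = 0
    · subst hμ
      rw [Function.update_self, faceVec_zero]
      have e1 : S' * ((L : ℤ) - 1) = S - S' := by rw [hSS]; ring
      have e2 : S' * ((L : ℤ) - 1 + 1) = S := by rw [hSS]; ring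
      rw [e1, e2]
      have : (1 : ℤ) ≤ S' := by omega
      constructor <;> linarith
    · rw [Function.update_of_ne hμ, hbase]
      have : (0 : ℤ) < S' := hS'pos
      constructor <;> nlinarith

/-- Hence they are JOINED in the touching-cube graph `touchC` (reading R2), at contour distance exactly `1`.
[cite: Balaban1984PropagatorsII, (2.46) p.231] -/
theorem touchC_dist_coarse_fine (b : FaceIdx d L) :
    (touchC M₁ L (twoScaleZ (d := d) M₁ L K N)).dist (coarseSite M₁ L K N hM₁ hL hN) (fineSite M₁ L K N hM₁ hL hK b) = 1 :=
  SimpleGraph.dist_eq_one_iff_adj.mpr (touchC_adj.mpr ⟨coarse_ne_fine b, touching_coarse_fine b⟩)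

/-! ## §3 The row sum of (2.61) under reading R2 at the coarse cube is at least `L^{d−1}e^{−σ}`: no L-free constant -/

/-- **LOWER BOUND FOR THE (2.61) ROW SUM UNDER READING R2.**  For every finite set `F` of cube-sites of the two-scale family
containing the coarse cube next to the refined cell and its `L^{d−1}` finer neighbours, and every rate `σ`:
`L^{d−1}·e^{−σ} ≤ Σ_{y′∈F} e^{−σ d_{R2}(y₀, y′)}` at the coarse cube `y₀` — each finer neighbour is at touching-contour distance
`1`. [cite: Balaban1984PropagatorsII, Lemma 2.1 (2.61) p.234, (2.46) p.231; Balaban1989LargeFieldI, p.179, p.186] -/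
theorem le_rowSum_touchGeo (F : Finset (CubeSite M₁ L (twoScaleZ (d := d) M₁ L K N)))
    (hs : coarseSite M₁ L K N hM₁ hL hN ∈ F) (hF : ∀ b, fineSite M₁ L K N hM₁ hL hK b ∈ F) (σ : ℝ) (kk : ℕ) (η R Mr : ℝ) :
    (L : ℝ) ^ (d - 1) * Real.exp (-σ) ≤
      ∑ y' : ↥F, Real.exp (-(σ * (touchGeo M₁ L (twoScaleZ (d := d) M₁ L K N) F kk η R Mr).dist
        ⟨coarseSite M₁ L K N hM₁ hL hN, hs⟩ y')) := by
  classical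
  set s₀ := coarseSite (d := d) M₁ L K N hM₁ hL hN with hs₀
  set f : CubeSite M₁ L (twoScaleZ (d := d) M₁ L K N) → ℝ :=
    fun x => Real.exp (-(σ * (((touchC M₁ L (twoScaleZ (d := d) M₁ L K N)).dist s₀ x : ℕ) : ℝ))) with hf
  have hrow : ∑ y' : ↥F, Real.exp (-(σ * (touchGeo M₁ L (twoScaleZ (d := d) M₁ L K N) F kk η R Mr).dist ⟨s₀, hs⟩ y'))
      = ∑ x ∈ F, f x := Finset.sum_coe_sort F f
  rw [hrow]
  have hterm : ∀ b : FaceIdx d L, f (fineSite M₁ L K N hM₁ hL hK b) = Real.exp (-σ) := by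
    intro b
    rw [hf]
    simp only
    rw [touchC_dist_coarse_fine b]
    simp
  calc (L : ℝ) ^ (d - 1) * Real.exp (-σ)
      = ∑ _b : FaceIdx d L, Real.exp (-σ) := by
        rw [Finset.sum_const, Finset.card_univ, card_faceIdx, nsmul_eq_mul]
        push_cast
        ring
    _ = ∑ b : FaceIdx d L, f (fineSite M₁ L K N hM₁ hL hK b) := Finset.sum_congr rfl fun b _ => (hterm b).symm
    _ = ∑ x ∈ Finset.univ.image (fineSite M₁ L K N hM₁ hL hK), f x :=
        (Finset.sum_image fun b _ c _ h => fineSite_injective h).symm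
    _ ≤ ∑ x ∈ F, f x := by
        refine Finset.sum_le_sum_of_subset_of_nonneg (fun x hx => ?_) fun _ _ _ => Real.exp_nonneg _
        obtain ⟨b, -, rfl⟩ := Finset.mem_image.mp hx
        exact hF b

/-- **NO `L`-FREE CONSTANT FOR (2.61) UNDER READING R2** (GAPS G-B6-22 item (iii), now kernel-certified): any `c < L^{d−1}e^{−σ}`
FAILS to bound the row sums of the touching-cube geometry of the two-scale family — while under print's literal reading R0 the same
row sums are bounded by the d-only `c₁″` (`B15LatticeCubeContours.sum_exp_le_latC`, `B15LatticeCubeTorus`), and under R2 by the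
`L`-dependent `K261` (`B15TouchingCubeContours.rowSum_touchGeo`). [cite: Balaban1984PropagatorsII, Lemma 2.1 (2.61) p.234, (2.46) p.231; Balaban1989LargeFieldI, p.186] -/
theorem not_rowSum_touchGeo (F : Finset (CubeSite M₁ L (twoScaleZ (d := d) M₁ L K N)))
    (hs : coarseSite M₁ L K N hM₁ hL hN ∈ F) (hF : ∀ b, fineSite M₁ L K N hM₁ hL hK b ∈ F) {σ c : ℝ} (kk : ℕ) (η R Mr : ℝ)
    (hc : c < (L : ℝ) ^ (d - 1) * Real.exp (-σ)) :
    ¬ RowSum (touchGeo M₁ L (twoScaleZ (d := d) M₁ L K N) F kk η R Mr) σ c := fun h =>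
  (lt_of_lt_of_le hc (le_rowSum_touchGeo F hs hF σ kk η R Mr)).not_ge (h ⟨_, hs⟩)

end Fixed

/-- The finite set of the witness: the coarse cube and its `L^{d−1}` finer neighbours. [cite: Balaban1984PropagatorsII, (2.45) p.231] -/
noncomputable def witnessF (M₁ L K N : ℕ) (hM₁ : 0 < M₁) (hL : 1 ≤ L) (hK : 1 ≤ K) (hN : 2 ≤ N) :
    Finset (CubeSite M₁ L (twoScaleZ (d := d) M₁ L K N)) := by
  classical
  exact insert (coarseSite M₁ L K N hM₁ hL hN) (Finset.univ.image (fineSite M₁ L K N hM₁ hL hK))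

/-- **FOR EVERY CANDIDATE CONSTANT `c` AND RATE `σ` THERE IS A NESTED CUBE FAMILY VIOLATING `RowSum σ c` UNDER R2** (`d ≥ 2`,
`M₁ ≥ 1`, `K ≥ 1`, `N ≥ 2`; `L = ⌈c·e^{σ}⌉ + 2`): the two-scale family `twoScaleZ M₁ L K N` — nested, one separating layer
(void), tiling, periodic (`B15LatticeCubeTorus` §5), so a legitimate instance of `B15TouchingCubeContours.lemma21_touchGeo` — with
the witness set of the coarse cube and its `L^{d−1}` finer neighbours.  The located reading GAPS G-B6-22 (iii) «no L-free (2.61)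
constant under R2» as a theorem. [cite: Balaban1984PropagatorsII, Lemma 2.1 (2.61) p.234, (2.46) p.231; Balaban1989LargeFieldI, p.179, p.186] -/
theorem exists_rowSum_violation (hd : 2 ≤ d) (hM₁ : 0 < M₁) (hK : 1 ≤ K) (hN : 2 ≤ N) (c σ : ℝ) (kk : ℕ) (η R Mr : ℝ) :
    ∃ (L : ℕ) (hL : 1 ≤ L),
      ¬ RowSum (touchGeo M₁ L (twoScaleZ (d := d) M₁ L K N) (witnessF M₁ L K N hM₁ hL hK hN) kk η R Mr) σ c := by
  classical
  refine ⟨⌈c * Real.exp σ⌉₊ + 2, by omega, ?_⟩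
  refine not_rowSum_touchGeo _ (Finset.mem_insert_self _ _)
    (fun b => Finset.mem_insert_of_mem (Finset.mem_image_of_mem _ (Finset.mem_univ b))) kk η R Mr ?_
  set L : ℕ := ⌈c * Real.exp σ⌉₊ + 2 with hLdef
  have hL1 : (1 : ℝ) ≤ L := by exact_mod_cast (show 1 ≤ L by omega)
  have hLc : c * Real.exp σ < L := by
    have h1 := Nat.le_ceil (c * Real.exp σ)
    have h2 : (L : ℝ) = (⌈c * Real.exp σ⌉₊ : ℝ) + 2 := by rw [hLdef]; push_cast; ring
    rw [h2]
    linarith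
  have hpow : (L : ℝ) ≤ (L : ℝ) ^ (d - 1) := le_self_pow₀ hL1 (by omega)
  have hexp : 0 < Real.exp (-σ) := Real.exp_pos _
  calc c = c * Real.exp σ * Real.exp (-σ) := by
        rw [mul_assoc, ← Real.exp_add, add_neg_cancel, Real.exp_zero, mul_one]
    _ < L * Real.exp (-σ) := mul_lt_mul_of_pos_right hLc hexp
    _ ≤ (L : ℝ) ^ (d - 1) * Real.exp (-σ) := mul_le_mul_of_nonneg_right hpow hexp.le

end Literature.MathematicalPhysics.QuantumFieldTheory.Balaban1983to89.B15TouchingCubeLowerBound
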